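import Summits.Ventures.PercRepro.ProfileGapMonoThresholdTwo

/-!
# PercRepro — THE ROW `(q−1, q)` IS THE THRESHOLD STATEMENT AT OFFSET `0` (p5, gen 24; `proofs/P5-GM1.md` §23;
announced INBOX 11995)

COMPLEMENTATION.  The rank-`(q−1)` sets of co-rank `≥ q` are those of co-rank exactly `q` (demand exactly `q`
each) and those of co-rank `≥ q + 1`; the rank-`q` sets of co-rank `≥ q − 1` are those of co-rank exactly `q − 1`
and those of co-rank `≥ q`; and `S ↦ E ∖ S` is a bijection from the rank-`q` sets of co-rank `q − 1` onto the
rank-`(q−1)` sets of co-rank `q`.  Hence the threshold gaps at the offsets `−1` and `0` coincide as functionals,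
`Φ_{q−1}(N) = Φ_q(N)`: `(I_{q−1})` — the row `(q−1, q)` of the profile — is `(I_q)`, the deletion statements
`DelMonoT N z q (q−1)` and `DelMonoT N z q q` coincide, and so do the rules on the hard class.
CONSEQUENCES.  (1) The assembly of `ProfileGapMonoThresholdHard` needs NO row hypothesis: the coloop case at the
offset `0` asks for `(I_{q−1})` of the deletion, which is `(I_q)` of the deletion — the inner induction
hypothesis.  So the whole family at offsets `≥ 0`, and with it THE ROWS `(q−1, q)` OF EVERY CO-RANK `q ≥ 2`,
follow from the rule on the hard class `HardRuleT α q' t'` (`2 ≤ q' ≤ q`, `q' ≤ t'`) alone.  (2) `(I_3)` at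
co-rank `3` is a theorem (from the row `(2, 3)`).

* `thresholdSum_pred_eq_add`, `card_levelSetCoQ_pred_eq_add`, **`thresholdIneq_pred_iff`**, `delMonoT_pred_iff`,
  `hardRuleT_pred_iff`, `thresholdIneq_of_hardRuleT_aux'`, **`thresholdIneq_of_hardRuleT'`**,
  `thresholdIneq_row_of_hardRuleT'`, **`profileIneqMinusQ_pred_of_hardRuleT`**, **`thresholdIneq_three_three`**.
-/

open scoped Matroid

namespace PercRepro.Cogirth

open Finset ThmH Skew Shadow Profile

variable {α : Type} [DecidableEq α] {M : Matroid α} [M.Finite]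

section Complement

variable {N : Matroid α} [N.Finite] {q : ℕ}

/-- The threshold demand at the offset `−1` is the demand at the offset `0` plus `q` for every rank-`(q−1)` set of
co-rank exactly `q` (`1 ≤ q`). -/
theorem thresholdSum_pred_eq_add (hq : 1 ≤ q) :
    thresholdSum N q (q - 1) =
      thresholdSum N q q + q * ((Rq N (q - 1)).filter (fun B => rk N (gr N \ B) = q)).card := by
  unfold thresholdSum
  have h1 : q - 1 + 1 = q := by omega
  have hterm : ∀ B ∈ Rq N (q - 1),
      (if q - 1 + 1 ≤ rk N (gr N \ B) then rk N (gr N \ B) else 0) =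
        (if q + 1 ≤ rk N (gr N \ B) then rk N (gr N \ B) else 0) +
          (if rk N (gr N \ B) = q then q else 0) := by
    intro B _
    rw [h1]
    by_cases hlt : q + 1 ≤ rk N (gr N \ B)
    · rw [if_pos (by omega), if_pos hlt, if_neg (by omega), add_zero]
    · by_cases heq : rk N (gr N \ B) = q
      · rw [if_pos (by omega), if_neg hlt, if_pos heq, zero_add, heq]
      · rw [if_neg (by omega), if_neg hlt, if_neg heq]
  rw [sum_congr rfl hterm, sum_add_distrib]
  congr 1
  rw [sum_ite, sum_const_zero, add_zero, sum_const, smul_eq_mul, mul_comm]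

/-- The rank-`q` sets of co-rank `≥ q − 1` are those of co-rank `≥ q` plus those of co-rank exactly `q − 1`, and
the latter are in bijection (`S ↦ E ∖ S`) with the rank-`(q−1)` sets of co-rank exactly `q` (`1 ≤ q`). -/
theorem card_levelSetCoQ_pred_eq_add (hq : 1 ≤ q) :
    (levelSetCoQ N (q - 1) q).card =
      (levelSetCoQ N q q).card + ((Rq N (q - 1)).filter (fun B => rk N (gr N \ B) = q)).card := by
  have hsplit := card_filter_add_card_filter_not (s := levelSetCoQ N (q - 1) q)
    (p := fun S => q ≤ rk N (gr N \ S))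
  have hA : (levelSetCoQ N (q - 1) q).filter (fun S => q ≤ rk N (gr N \ S)) = levelSetCoQ N q q := by
    ext S
    rw [mem_filter, mem_levelSetCoQ, mem_levelSetCoQ]
    constructor
    · rintro ⟨⟨h1, _⟩, h2⟩
      exact ⟨h1, h2⟩
    · rintro ⟨h1, h2⟩
      exact ⟨⟨h1, by omega⟩, h2⟩
  have hB : ((levelSetCoQ N (q - 1) q).filter (fun S => ¬ q ≤ rk N (gr N \ S))).card =
      ((Rq N (q - 1)).filter (fun B => rk N (gr N \ B) = q)).card := by
    apply card_nbij' (fun S => gr N \ S) (fun B => gr N \ B)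
    · intro S hS
      have hS' : S ∈ (levelSetCoQ N (q - 1) q).filter (fun S => ¬ q ≤ rk N (gr N \ S)) := by simpa using hS
      rw [mem_filter, mem_levelSetCoQ] at hS'
      obtain ⟨⟨⟨hSg, hSq⟩, hS1⟩, hS2⟩ := hS'
      have hmem : gr N \ S ∈ (Rq N (q - 1)).filter (fun B => rk N (gr N \ B) = q) := by
        rw [mem_filter, mem_Rq]
        refine ⟨⟨sdiff_subset, ?_⟩, ?_⟩
        · apply eRk_eq_of_rk_eq_cq
          omega
        · rw [Finset.sdiff_sdiff_eq_self hSg]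
          exact rk_eq_of_eRk_eq_cq hSq
      simpa using hmem
    · intro B hB
      have hB' : B ∈ (Rq N (q - 1)).filter (fun B => rk N (gr N \ B) = q) := by simpa using hB
      rw [mem_filter, mem_Rq] at hB'
      obtain ⟨⟨hBg, hBq⟩, hB2⟩ := hB'
      have hBrk : rk N B = q - 1 := rk_eq_of_eRk_eq_cq hBq
      have hmem : gr N \ B ∈ (levelSetCoQ N (q - 1) q).filter (fun S => ¬ q ≤ rk N (gr N \ S)) := by
        rw [mem_filter, mem_levelSetCoQ]
        refine ⟨⟨⟨sdiff_subset, eRk_eq_of_rk_eq_cq hB2⟩, ?_⟩, ?_⟩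
        · rw [Finset.sdiff_sdiff_eq_self hBg, hBrk]
        · rw [Finset.sdiff_sdiff_eq_self hBg, hBrk]
          omega
      simpa using hmem
    · intro S hS
      have hS' : S ∈ (levelSetCoQ N (q - 1) q).filter (fun S => ¬ q ≤ rk N (gr N \ S)) := by simpa using hS
      rw [mem_filter, mem_levelSetCoQ] at hS'
      exact Finset.sdiff_sdiff_eq_self hS'.1.1.1
    · intro B hB
      have hB' : B ∈ (Rq N (q - 1)).filter (fun B => rk N (gr N \ B) = q) := by simpa using hB
      rw [mem_filter, mem_Rq] at hB'
      exact Finset.sdiff_sdiff_eq_self hB'.1.1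
  rw [← hsplit, hA, hB]

/-- **The row `(q−1, q)` is the threshold statement at the offset `0`** (`1 ≤ q`): `(I_{q−1}) ↔ (I_q)`. -/
theorem thresholdIneq_pred_iff (hq : 1 ≤ q) : ThresholdIneq N q (q - 1) ↔ ThresholdIneq N q q := by
  unfold ThresholdIneq
  rw [thresholdSum_pred_eq_add hq, card_levelSetCoQ_pred_eq_add hq, mul_add]
  exact add_le_add_iff_right _

/-- The deletion statements at the offsets `−1` and `0` coincide (`1 ≤ q`). -/
theorem delMonoT_pred_iff {z : α} (hq : 1 ≤ q) : DelMonoT N z q (q - 1) ↔ DelMonoT N z q q := by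
  unfold DelMonoT
  rw [thresholdSum_pred_eq_add (N := N) hq, thresholdSum_pred_eq_add (N := N ＼ ({z} : Set α)) hq,
    card_levelSetCoQ_pred_eq_add (N := N) hq, card_levelSetCoQ_pred_eq_add (N := N ＼ ({z} : Set α)) hq,
    mul_add, mul_add]
  constructor
  · intro h; omega
  · intro h; omega

/-- The rules on the hard class at the offsets `−1` and `0` coincide (`1 ≤ q`). -/
theorem hardRuleT_pred_iff (hq : 1 ≤ q) : HardRuleT α q (q - 1) ↔ HardRuleT α q q := by
  unfold HardRuleT
  constructor
  · intro h N _ hN hne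
    obtain ⟨z, hz, hdm⟩ := h N hN hne
    exact ⟨z, hz, (delMonoT_pred_iff hq).1 hdm⟩
  · intro h N _ hN hne
    obtain ⟨z, hz, hdm⟩ := h N hN hne
    exact ⟨z, hz, (delMonoT_pred_iff hq).2 hdm⟩

/-- The inner induction on `#E` at a fixed co-rank `q ≥ 2` WITHOUT a row hypothesis: the coloop case at the offset
`0` uses `(I_{q−1})` of the deletion, which is `(I_q)` of the deletion — the induction hypothesis. -/
theorem thresholdIneq_of_hardRuleT_aux' {q : ℕ} (hq : 2 ≤ q)
    (hprev : ∀ (K : Matroid α) [K.Finite] (t' : ℕ), q - 1 ≤ t' → ThresholdIneq K (q - 1) t')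
    (hrule : ∀ t', q ≤ t' → HardRuleT α q t') (n : ℕ) :
    ∀ (N : Matroid α) [N.Finite], (gr N).card = n → ∀ t, q ≤ t → ThresholdIneq N q t := by
  induction n using Nat.strong_induction_on with
  | _ n ih =>
  intro N _ hN t hqt
  have ihdel : ∀ z ∈ gr N, ∀ t', q ≤ t' → ThresholdIneq (N ＼ ({z} : Set α)) q t' := by
    intro z hz t' ht'
    have hlt : ((gr N).erase z).card < n := by rw [← hN]; exact card_erase_lt_of_mem hz
    exact ih _ hlt (N ＼ ({z} : Set α)) (by rw [gr_delete']) t' ht'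
  have ihdel' : ∀ z ∈ gr N, ∀ t', q - 1 ≤ t' → ThresholdIneq (N ＼ ({z} : Set α)) q t' := by
    intro z hz t' ht'
    rcases Nat.lt_or_ge t' q with h | h
    · have : t' = q - 1 := by omega
      rw [this]
      exact (thresholdIneq_pred_iff (by omega)).2 (ihdel z hz q (le_refl q))
    · exact ihdel z hz t' h
  rcases (gr N).eq_empty_or_nonempty with hempty | hne
  · exact thresholdIneq_of_card_eq_zero (by rw [hempty, card_empty])
  -- a loop
  by_cases hloop : ∃ ℓ ∈ gr N, rk N {ℓ} = 0
  · obtain ⟨ℓ, hℓ, h0⟩ := hloop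
    exact thresholdIneq_of_loop hℓ h0 (ihdel ℓ hℓ t hqt)
  -- a parallel pair
  by_cases hpar : ∃ z ∈ gr N, ∃ z' ∈ gr N, z ≠ z' ∧ rk N {z, z'} = 1
  · obtain ⟨z, hz, z', hz', hzz', hpar⟩ := hpar
    have hz1 : rk N {z} = 1 := by
      have h1 := rk_mono' (M := N) (show ({z} : Finset α) ⊆ {z, z'} by simp)
      have h2 : rk N {z} ≠ 0 := fun h => hloop ⟨z, hz, h⟩
      omega
    have hz'1 : rk N {z'} = 1 := by
      have h1 := rk_mono' (M := N) (show ({z'} : Finset α) ⊆ {z, z'} by simp)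
      have h2 : rk N {z'} ≠ 0 := fun h => hloop ⟨z', hz', h⟩
      omega
    have hdm := delMonoT_of_parallel hz hz' hzz' hz1 hz'1 hpar hq (by omega)
      (hprev _ (t - 1) (by omega))
    exact thresholdIneq_of_delMonoT hdm (ihdel z hz t hqt)
  -- a coloop
  by_cases hcol : ∃ z ∈ gr N, rk N ((gr N).erase z) + 1 = rk N (gr N)
  · obtain ⟨z, hz, hzc⟩ := hcol
    exact thresholdIneq_of_coloop hz hzc hq (by omega) (ihdel' z hz (t - 1) (by omega))
      (hprev _ t (by omega))
  -- a generic point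
  by_cases hgen : ∃ z ∈ gr N, GenericQ N z q
  · obtain ⟨z, hz, hg⟩ := hgen
    have hz1 : rk N {z} = 1 := by
      have h2 : rk N {z} ≠ 0 := fun h => hloop ⟨z, hz, h⟩
      have h3 : rk N {z} ≤ 1 := by
        have := rk_le_card (M := N) ({z} : Finset α)
        simpa using this
      omega
    have hzI : N.Indep {z} := by
      have h := indep_of_rk_eq_card (M := N) (X := {z}) (by rw [card_singleton]; exact hz1)
      rwa [coe_singleton] at h
    have hdm := delMonoT_of_genericQ hzI hg hq (by omega) (hprev _ (t - 1) (by omega))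
    exact thresholdIneq_of_delMonoT hdm (ihdel z hz t hqt)
  -- the hard class: the rule
  have hhard : HardT N q := by
    refine ⟨?_, ?_, ?_, ?_⟩
    · intro x hx
      have h2 : rk N {x} ≠ 0 := fun h => hloop ⟨x, hx, h⟩
      have h3 : rk N {x} ≤ 1 := by
        have := rk_le_card (M := N) ({x} : Finset α)
        simpa using this
      omega
    · intro x hx y hy hxy h
      exact hpar ⟨x, hx, y, hy, hxy, h⟩
    · intro x hx h
      exact hcol ⟨x, hx, h⟩
    · intro x hx h
      exact hgen ⟨x, hx, h⟩
  obtain ⟨z, hz, hdm⟩ := hrule t hqt N hhard hne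
  exact thresholdIneq_of_delMonoT hdm (ihdel z hz t hqt)

/-- **The threshold family at every offset `≥ 0` from the rule on the hard class ALONE**: for `2 ≤ q ≤ t`, `(I_t)`
on every finite matroid, given `HardRuleT α q' t'` for all `2 ≤ q' ≤ q`, `q' ≤ t'`. -/
theorem thresholdIneq_of_hardRuleT' (hrule : ∀ q' t', 2 ≤ q' → q' ≤ t' → HardRuleT α q' t') :
    ∀ q, 2 ≤ q → ∀ (N : Matroid α) [N.Finite], ∀ t, q ≤ t → ThresholdIneq N q t := by
  intro q
  induction q with
  | zero => intro h; omega
  | succ q ihq =>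
    intro hq N _ t hqt
    have hprev : ∀ (K : Matroid α) [K.Finite] (t' : ℕ), q + 1 - 1 ≤ t' → ThresholdIneq K (q + 1 - 1) t' := by
      intro K _ t' ht'
      rw [Nat.add_sub_cancel] at ht' ⊢
      rcases Nat.lt_or_ge q 2 with h | h
      · have : q = 1 := by omega
        rw [this]; exact thresholdIneq_one K t'
      · exact ihq h K t' ht'
    exact thresholdIneq_of_hardRuleT_aux' hq hprev (fun t' ht' => hrule (q + 1) t' hq ht') _ N rfl t hqt

/-- **The rows `(q−1, q)` of every co-rank `q ≥ 2` from the rule on the hard class alone** (threshold form). -/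
theorem thresholdIneq_row_of_hardRuleT' (hrule : ∀ q' t', 2 ≤ q' → q' ≤ t' → HardRuleT α q' t') {q : ℕ}
    (hq : 2 ≤ q) (N : Matroid α) [N.Finite] : ThresholdIneq N q (q - 1) :=
  (thresholdIneq_pred_iff (by omega)).2 (thresholdIneq_of_hardRuleT' hrule q hq N q (le_refl q))

/-- **The rows `(q−1, q)` of the profile, every co-rank `q ≥ 2`, from the rule on the hard class alone.** -/
theorem profileIneqMinusQ_pred_of_hardRuleT (hrule : ∀ q' t', 2 ≤ q' → q' ≤ t' → HardRuleT α q' t') {q : ℕ}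
    (hq : 2 ≤ q) (N : Matroid α) [N.Finite] : ProfileIneqMinusQ N (q - 1) q :=
  (thresholdIneq_iff_row (by omega)).1 (thresholdIneq_row_of_hardRuleT' hrule hq N)

/-- **`(I_3)` at co-rank `3` is a theorem**: it is the row `(2, 3)`. -/
theorem thresholdIneq_three_three (K : Matroid α) [K.Finite] : ThresholdIneq K 3 3 :=
  (thresholdIneq_pred_iff (by norm_num)).1 (thresholdIneq_row_of_le_three K (by norm_num) (by norm_num))

end Complement

end PercRepro.Cogirth
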